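import Mathlib.Analysis.InnerProductSpace.PiL2
import Mathlib.Analysis.Normed.Module.Connected
import Mathlib.Geometry.Manifold.Instances.Real
import Mathlib.Geometry.Manifold.Instances.Sphere
import Mathlib.Geometry.Manifold.Diffeomorph
import Mathlib.Geometry.Manifold.SmoothEmbedding
import Mathlib.Geometry.Manifold.Riemannian.Basic
import Literature.Geometry.Lorentzian.KerrData
import Literature.Geometry.Lorentzian.Development
import Literature.Geometry.Lorentzian.NullInfinity
import Literature.Geometry.Lorentzian.TrappedSurface
import HarnessLib

-- provenance: harness21/H21/H21/Prelude/Lorentz/ModelData.lean @ 428fea4 (interim HEAD d8f2665); M5 mechanical rewrite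
-- D-0014 sorry-free migration + `Kerr.Facts`/`Kerr.SliceFacts`/`HasLeviCivita`/`IsMOTSInData` dependency-drift fix (literature-prover-sweep-Geometry-Lorentzian-Stability-0, 2026-08-13)
-- discharge `Minkowski.isSmoothEmbedding_sliceEmbed_holds` appended (literature-prover provefact, 2026-08-15)
/-!
# Model initial data sets and sanity objects (trunk G08 = T-LORENTZ, item C18)

Family `gr`, notions `kerr_schwarzschild_family` (½) and `null_infinity_intrinsic_completeness`;
statement id `gr.S17` ('Minkowski; Schwarzschild `a = 0`; induced data') on `trivialData` and
`Schwarzschild.timeSymmetricData`. This file supplies the explicit model data sets consumed by the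
statement files (`Stability`, `MassInequalities`, `CosmicCensorship`) and the *mandatory sanity
statements* for the sojourn form of completeness of future null infinity (Outline §4.2; review
findings F3, F4, F7).

## Contents (namespace `Literature.Lorentz`)

* Generic plumbing: `contMDiff_zero_bilinSection` (the tensor `k = 0` is a smooth section, via
  Mathlib's `Bundle.contMDiff_zeroSection`); `contDiffOn_smul_const'`;
  `OpensSection.contMDiff_bilinSection` — over an open subset `U` of a normed space the
  preferred trivializations of `T U` are the identity (`OpensSection.trivializationAt_apply`),
  so a section of the bundle of bilinear forms is `C^n` iff its values are (proved; this makes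
  the flat and the conformally flat metrics below honest smooth sections); `inclusionAFEnd V R`
  — the tautological asymptotically flat end `{R < ‖y‖} ⊆ V` of an open `V ⊆ E3` containing it
  (chart = inclusion, as for `Kerr.afEnd`; smoothness of both chart maps proved).
* Minkowski: `Minkowski.slice : Opens E3 := ⊤` (own definition, own `ConnectedSpace` instance),
  `Minkowski.sliceEmbed` (`y ↦ (0, y)`), `Minkowski.sliceNormal` (`∂ₜ`), `Minkowski.flatMetric`
  (`δ = innerSL ℝ` on every fibre), **`trivialData`** `= (ℝ³, δ, 0)`, `trivialAFEnd`
  (`U = {1 < ‖y‖}`), `Minkowski.smoothMetric`, `Minkowski.development : VacuumDevelopment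
  trivialData` (carrier `E4`, all data fields explicit, `Prop` fields the named facts bundled in the
  instance hypothesis `[Minkowski.DevelopmentFacts]`); named facts (`def … : Prop`, D-0014)
  `trivialData_isVacuumConstraintSolution`, `trivialAFEnd_isStronglyAsymptoticallyFlatCK`
  (mass `0`), `hasADMEnergy_trivialData` (with the proved consequence `admEnergy_trivialData`),
  `isComplete_trivialData`, `Minkowski.development_isMaximal` (Minkowski is the MGHD of the
  trivial data), and the sanity statements `minkowski_hasCompleteFutureNullInfinity`,
  `kerr_hasCompleteFutureNullInfinity` (with `Kerr.farSlice`, `Kerr.farSliceEmbed`,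
  `Kerr.farSliceNormal`); the named fact `Minkowski.isSmoothEmbedding_sliceEmbed` is *discharged*
  at the end of the file (`Minkowski.isSmoothEmbedding_sliceEmbed_holds`, Hawking–Ellis 1973, §2.3, §5.1).
* Time-symmetric Schwarzschild in isotropic coordinates: `Schwarzschild.conformalFactor M y =
  1 + M/(2‖y‖)`, `Schwarzschild.conformalData U hM hU = (U, ψ⁴ δ, 0)` for `0 ∉ U`,
  `Schwarzschild.puncturedSlice = E3 ∖ {0}`, `Schwarzschild.isotropicExterior M = {M/2 < ‖y‖}`,
  **`Schwarzschild.timeSymmetricData`** (complete, two-ended), `Schwarzschild.timeSymmetricExteriorData`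
  (the RPI rigidity model, on the connected `isotropicExterior`, connectedness proved),
  `Schwarzschild.afEnd`; named facts `Schwarzschild.conformalData_isVacuumConstraintSolution`,
  `Schwarzschild.isAsymptoticallyFlat_timeSymmetricExteriorData`,
  `Schwarzschild.hasADMEnergy_timeSymmetricExteriorData` (`= M`, with the proved consequence
  `admEnergy_timeSymmetricExteriorData`), `Schwarzschild.isComplete_timeSymmetricData`
  (`0 < M`), and the throat `Schwarzschild.throatEmbed : S² → puncturedSlice` (`p ↦ (M/2) p`, on
  Mathlib's `Metric.sphere (0 : E3) 1`) with the named facts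
  `Schwarzschild.isSpacelikeImmersion_throatEmbed`, `Schwarzschild.isMOTSInData_throat`
  (`H = 0` on `‖y‖ = M/2`).

The non-time-symmetric *ingoing* Schwarzschild slice is `Kerr.data M 0 r₀` (`KerrData`).

## Mathlib

Mathlib (at the pin) has the flat Riemannian metric on an inner product space,
`riemannianMetricVectorSpace F : ContMDiffRiemannianMetric 𝓘(ℝ, F) ω F …`
(`Mathlib/Geometry/Manifold/Riemannian/Basic.lean`), but only on the vector space itself, not on
its open submanifolds `U : Opens F` (there is no restriction map for
`Bundle.ContMDiffRiemannianMetric`); we reuse its `isVonNBounded` field fibrewise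
(`Minkowski.isVonNBounded_inner_slice`, `Schwarzschild.isVonNBounded_conformalInner`) and prove
smoothness of the constant/conformal sections from `Bundle.contMDiffAt_section`,
`hom_trivializationAt_apply` and `FiberBundleCore.coordChange_self`
(`OpensSection.contMDiff_bilinSection`). We use `innerSL ℝ` for `δ`,
`Bundle.contMDiff_zeroSection`, `contDiffAt_norm`, `isConnected_sphere`,
`Metric.sphere (0 : E3) 1` with
`EuclideanSpace.instIsManifoldSphere`, `isConnected_compl_singleton_of_one_lt_rank`,
`TopologicalSpace.Opens` as open submanifolds and `Diffeomorph`. Mathlib has no Minkowski /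
Schwarzschild data, developments or null infinity (`rg -i 'schwarzschild|initial data'
Mathlib/Geometry` is empty); those come from the H21 modules `KerrSchild`, `KerrData`,
`InitialData`, `AsymptoticFlatness`, `Development`, `NullInfinity`, `TrappedSurface`.

## Design choices

* **Instances on the carrier of a development.** `Development.carrier` for
  `Minkowski.development` is `Minkowski.spacetime.carrier = E4` with the instances stored in
  the structure; these agree with the ambient instances of `E4` by unfolding the definition
  `Minkowski.spacetime`, but *not* at instance transparency. The side lemmas are therefore
  stated for `Minkowski.smoothMetric := Minkowski.metric.ofLE le_top : LorentzianMetric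
  𝓘(ℝ, E4) ∞ E4` (by `rfl` the metric of `Minkowski.spacetime`, `Minkowski.spacetime_metric`)
  and models `𝓘(ℝ, E3)`, `𝓘(ℝ, E4)` (`= 𝓡 3`, `𝓡 4` by `rfl`); the structure fields then accept
  them by definitional unfolding.
* **`0 ≤ M` for the conformal data.** `ψ⁴ δ` is positive definite iff `ψ ≠ 0`; for `M ≥ 0`,
  `ψ ≥ 1` everywhere (`Schwarzschild.one_le_conformalFactor`), which gives `pos` and
  `isVonNBounded` *directly* (the `h`-unit ball sits inside the Euclidean one). Smoothness of
  `y ↦ ψ(y)⁴ δ` needs `0 ∉ U` and is proved for every real `M` (`contDiffAt_norm` off the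
  origin). `conformalFactor` is total with junk value `ψ(0) = 1` (`M/0 = 0`), never used since
  `0 ∉ U`.
* **Two Schwarzschild slices.** `timeSymmetricData M hM` lives on `E3 ∖ {0}` (complete and
  two-ended for `M > 0`, minimal throat `‖y‖ = M/2`); `timeSymmetricExteriorData M hM` on
  `{M/2 < ‖y‖}` is the open exterior of the throat, the model in the rigidity statement of the
  Riemannian Penrose inequality (Bray 2001; Huisken–Ilmanen 2001). Both are
  `conformalData` on different opens.
* **The throat as a manifold.** The MOTS statement uses Mathlib's unit sphere
  `Metric.sphere (0 : E3) 1` (charted on `EuclideanSpace ℝ (Fin 2)`, analytic) and the dilation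
  `p ↦ (M/2) p`, `M > 0`, with outward `h`-unit normal `p/4` (`ψ = 2` on the throat). The
  spacelike-immersion side condition `hf` of `IsMOTSInData` is the named fact
  `isSpacelikeImmersion_throatEmbed`, a leading binder of the named fact `isMOTSInData_throat`
  together with the pullback-smoothness fact `hpb` and the Levi-Civita hypothesis (drifted
  signature of `IsMOTSInData`, `TrappedSurface`).
* **M5 migration (D-0014, sorry-free Literature).** The dependencies drifted as follows:
  `Kerr.smoothMetric`/`Kerr.timeOrientation` take the instance hypothesis `[Kerr.Facts]`
  (`KerrSchild`); the constraint functions, `IsComplete`, `secondFundamentalForm`, `IsRicciFlat`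
  and the null-ray notions take the standing Levi-Civita hypothesis `[g.HasLeviCivita]`
  (`InitialData`, `Hypersurface`, `Einstein`, `NullInfinity`); `IsMOTSInData` takes `hpb`, `hf`.
  Everything provable at Mathlib level is proved (chart smoothness of inclusion ends, smoothness
  of the flat and conformally flat sections, connectedness of the isotropic exterior, smoothness
  of `ψ` off the origin). The results proved in print but not here are named facts
  `def … : Prop` whose hypotheses (`0 ≤ M`, `0 < M`, `0 ∉ U`, `[….HasLeviCivita]`, `hpb`, `hf`)
  are leading binders. Those on which the *bundled* development `Minkowski.development`
  depends are the fields of the `Prop` class `Minkowski.DevelopmentFacts`, taken as an instance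
  hypothesis (house pattern `Kerr.Facts`, `Kerr.SliceFacts`), so that `trivialData`,
  `Minkowski.development`, `Schwarzschild.timeSymmetricData` keep their signatures; `trivialData`
  and the Schwarzschild data need no hypothesis at all.
* **Kerr sanity statement (deviation, documented on the theorem).** The outline planned
  `kerr_hasCompleteFutureNullInfinity` with ray origins ranging over all of `Kerr.slice a r₀`.
  Since `HasCompleteFutureNullInfinity` only exempts a *compact* set of origins and the chart
  slice `{r > max r₀ 0}` has an inner coordinate edge (rays starting next to it leave the chart at
  once), that literal statement is false for all parameters. We state it for the smooth Kerr
  chart metric `Kerr.smoothMetric M a r₀` with origins in the closed far region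
  `Kerr.farSlice a r₀ = {afRadius + 1 ≤ ‖y‖}` (`Kerr.farSliceEmbed = sliceEmbed ∘ incl`,
  `Kerr.farSliceNormal`), whose only end is infinity; this is true for the sojourn form for all
  `M ≥ 0`, `a`, `r₀` (Outline §4.2 test table). (Not a development: the Kerr–Schild slice is not
  a Cauchy surface of the chart, see `KerrData`.)

## References

* S. W. Hawking, G. F. R. Ellis, *The large scale structure of space-time*, CUP 1973, §5.1.
* D. Christodoulou, S. Klainerman, *The global nonlinear stability of the Minkowski space*,
  Princeton 1993, §1, (1.0.9).
* Y. Choquet-Bruhat, R. Geroch, *Global aspects of the Cauchy problem in general relativity*,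
  Comm. Math. Phys. 14 (1969) 329–335.
* D. Christodoulou, *On the global initial value problem and the issue of singularities*,
  Class. Quantum Grav. 16 (1999) A23–A35, pp. A26–A27.
* M. Dafermos, I. Rodnianski, *Lectures on black holes and linear waves*, arXiv:0811.0354,
  §2.6.2, §5.1.
* C. W. Misner, K. S. Thorne, J. A. Wheeler, *Gravitation*, Freeman 1973, (31.22), §31.7.
* D. R. Brill, R. W. Lindquist, *Interaction energy in geometrostatics*, Phys. Rev. 131 (1963)
  471–476.
* H. L. Bray, *Proof of the Riemannian Penrose inequality using the positive mass theorem*,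
  J. Differential Geom. 59 (2001) 177–267, §1, Thm. 1.
* G. Huisken, T. Ilmanen, *The inverse mean curvature flow and the Riemannian Penrose
  inequality*, J. Differential Geom. 59 (2001) 353–437, §1.
* R. Bartnik, *The mass of an asymptotically flat manifold*, CPAM 39 (1986), §1, (4.2), Thm. 4.2.
* R. Bartnik, J. Isenberg, *The constraint equations*, in: The Einstein equations and the large
  scale behavior of gravitational fields, Birkhäuser 2004, §2–3.
* R. P. Kerr, PRL 11 (1963) 237; B. O'Neill, *The Geometry of Kerr Black Holes*, 1995, Ch. 2.
-/

noncomputable section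

open Bundle TopologicalSpace Manifold Set
open scoped ContDiff Topology InnerProductSpace

namespace Literature.Geometry.Lorentzian

/-! ### Generic plumbing: zero tensor, inclusion ends of open subsets of `E3` -/

section Generic

variable {X : Type*} [TopologicalSpace X] [ChartedSpace E3 X] [IsManifold 𝓘(ℝ, E3) ∞ X]

/-- The zero section `x ↦ 0` of the bundle of bilinear forms on `TX` is smooth (Mathlib's
`Bundle.contMDiff_zeroSection`); used for the tensor `k = 0` of time-symmetric data.
Bartnik–Isenberg 2004, §2 (time-symmetric data). [cite: BartnikIsenberg2004, §2 (time-symmetric data] -/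
theorem contMDiff_zero_bilinSection :
    ContMDiff 𝓘(ℝ, E3) (𝓘(ℝ, E3).prod 𝓘(ℝ, E3 →L[ℝ] E3 →L[ℝ] ℝ)) ∞
      (fun x : X ↦ TotalSpace.mk' (E3 →L[ℝ] E3 →L[ℝ] ℝ)
        (E := fun y : X ↦ TangentSpace 𝓘(ℝ, E3) y →L[ℝ] TangentSpace 𝓘(ℝ, E3) y →L[ℝ] ℝ)
        x 0) :=
  Bundle.contMDiff_zeroSection ℝ
    (fun y : X ↦ TangentSpace 𝓘(ℝ, E3) y →L[ℝ] TangentSpace 𝓘(ℝ, E3) y →L[ℝ] ℝ)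

/-- A `C^n` scalar function times a constant vector is `C^n` (composition of `f` with the
continuous linear map `c ↦ c • δ`, Mathlib's `ContinuousLinearMap.smulRight`; stated for a
general normed target so that instance search at the use site `F = (E3 →L E3 →L ℝ)` is
canonical). Elementary calculus. [folklore] -/
theorem contDiffOn_smul_const' {V F : Type*} [NormedAddCommGroup V] [NormedSpace ℝ V]
    [NormedAddCommGroup F] [NormedSpace ℝ F] {f : V → ℝ} {s : Set V}
    {n : ℕ∞ω} (hf : ContDiffOn ℝ n f s) (δ : F) : ContDiffOn ℝ n (fun y ↦ f y • δ) s :=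
  ((ContinuousLinearMap.smulRight (1 : ℝ →L[ℝ] ℝ) δ).contDiff.comp_contDiffOn hf).congr
    fun y _ ↦ by simp

end Generic

/-! ### Sections of the bundle of bilinear forms over an open subset of a normed space -/

namespace OpensSection

variable {F : Type*} [NormedAddCommGroup F] [NormedSpace ℝ F]

omit [NormedSpace ℝ F] in
/-- On an open subset `U` of a normed space all preferred charts coincide (they are the
restriction of the identity chart), so every point lies in the source of every chart.
O'Neill 1983, Ch. 3, p. 57 (open submanifolds). [folklore] -/
theorem mem_chartAt_source (U : Opens F) (x₀ y : U) : y ∈ (chartAt F x₀).source := by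
  change y ∈ (chartAt F y).source
  exact mem_chart_source F y

/-- On an open subset `U` of a normed space every point lies in the base set of every preferred
trivialization of the tangent bundle. O'Neill 1983, Ch. 3, p. 57. [folklore] -/
theorem mem_baseSet_trivializationAt (U : Opens F) (x₀ y : U) :
    y ∈ (trivializationAt F (TangentSpace 𝓘(ℝ, F)) x₀).baseSet :=
  mem_chartAt_source U x₀ y

/-- On an open subset `U` of a normed space `F` the preferred trivializations of the tangent
bundle are the identity `T U = U × F` (the coordinate change of a chart with itself is the
identity, `FiberBundleCore.coordChange_self`). O'Neill 1983, Ch. 3, p. 57; compare Mathlib's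
`TangentBundle.trivializationAt_model_space_apply`. [folklore] -/
theorem trivializationAt_apply (U : Opens F) (x₀ : U) (z : TangentBundle 𝓘(ℝ, F) U) :
    trivializationAt F (TangentSpace 𝓘(ℝ, F)) x₀ z = (z.1, z.2) := by
  rw [TangentBundle.trivializationAt_apply]
  congr 1
  change (tangentBundleCore 𝓘(ℝ, F) U).coordChange (achart F z.1) (achart F z.1) z.1 z.2 = z.2
  exact (tangentBundleCore 𝓘(ℝ, F) U).coordChange_self _ _ (mem_chart_source _ _) _

/-- The fibrewise linear part of the preferred trivialization of `T U` is the identity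
(`U` an open subset of a normed space). O'Neill 1983, Ch. 3, p. 57. [folklore] -/
theorem continuousLinearMapAt_apply (U : Opens F) (x₀ y : U) (v : TangentSpace 𝓘(ℝ, F) y) :
    (trivializationAt F (TangentSpace 𝓘(ℝ, F)) x₀).continuousLinearMapAt ℝ y v = v := by
  rw [Trivialization.continuousLinearMapAt_apply, Trivialization.linearMapAt_apply,
    if_pos (mem_baseSet_trivializationAt U x₀ y)]
  exact congrArg Prod.snd (trivializationAt_apply U x₀ ⟨y, v⟩)

/-- The inverse of the preferred trivialization of `T U` is the identity on fibres
(`U` an open subset of a normed space). O'Neill 1983, Ch. 3, p. 57. [folklore] -/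
theorem symm_apply (U : Opens F) (x₀ y : U) (v : F) :
    (trivializationAt F (TangentSpace 𝓘(ℝ, F)) x₀).symm y v = v := by
  have := (trivializationAt F (TangentSpace 𝓘(ℝ, F)) x₀).symm_apply_apply_mk
    (mem_baseSet_trivializationAt U x₀ y) v
  rwa [show (trivializationAt F (TangentSpace 𝓘(ℝ, F)) x₀) ⟨y, v⟩ = (y, v) from
    trivializationAt_apply U x₀ ⟨y, v⟩] at this

/-- The inverse fibre map `symmL` of the preferred trivialization of `T U` is the identity
(`U` an open subset of a normed space). O'Neill 1983, Ch. 3, p. 57. [folklore] -/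
theorem symmL_apply (U : Opens F) (x₀ y : U) (v : F) :
    (trivializationAt F (TangentSpace 𝓘(ℝ, F)) x₀).symmL ℝ y v = v := by
  rw [Trivialization.symmL_apply _ (mem_baseSet_trivializationAt U x₀ y)]
  exact symm_apply U x₀ y v

/-- **Sections of the bundle of bilinear forms on `T U`, `U` an open subset of a normed space
`F`, are `C^n` as sections as soon as they are `C^n` as maps `U → (F →L F →L ℝ)`**: in the
preferred trivializations (all equal to the identity, `trivializationAt_apply`) the coordinate
expression of the section `y ↦ s y` (`Bundle.contMDiffAt_section`, `hom_trivializationAt_apply`)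
is `s` itself. This is the plumbing that makes the constant section `δ` (`Minkowski.flatMetric`)
and the conformally flat section `ψ⁴ δ` (`Schwarzschild.conformalMetric`) honest smooth
Riemannian metrics. O'Neill 1983, Ch. 3, p. 55 and p. 57; compare Mathlib's
`riemannianMetricVectorSpace`. [folklore] -/
theorem contMDiff_bilinSection (U : Opens F) {n : ℕ∞ω} (s : U → F →L[ℝ] F →L[ℝ] ℝ)
    (hs : ContMDiff 𝓘(ℝ, F) 𝓘(ℝ, F →L[ℝ] F →L[ℝ] ℝ) n s) :
    ContMDiff 𝓘(ℝ, F) (𝓘(ℝ, F).prod 𝓘(ℝ, F →L[ℝ] F →L[ℝ] ℝ)) n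
      (fun y : U ↦ TotalSpace.mk' (F →L[ℝ] F →L[ℝ] ℝ)
        (E := fun x : U ↦ TangentSpace 𝓘(ℝ, F) x →L[ℝ] TangentSpace 𝓘(ℝ, F) x →L[ℝ] ℝ)
        y (s y)) := by
  intro x₀
  rw [contMDiffAt_section]
  refine (hs x₀).congr_of_eventuallyEq (Filter.Eventually.of_forall fun y ↦ ?_)
  show ((trivializationAt (F →L[ℝ] F →L[ℝ] ℝ)
    (fun x : U ↦ TangentSpace 𝓘(ℝ, F) x →L[ℝ] TangentSpace 𝓘(ℝ, F) x →L[ℝ] ℝ) x₀) ⟨y, s y⟩).2 = s y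
  ext v w
  rw [hom_trivializationAt_apply]
  simp only [ContinuousLinearMap.inCoordinates, ContinuousLinearMap.comp_apply]
  rw [symmL_apply, Trivialization.continuousLinearMapAt_apply,
    Trivialization.linearMapAt_apply,
    if_pos (by simpa [hom_trivializationAt_baseSet] using mem_chartAt_source U x₀ y)]
  change ((trivializationAt (F →L[ℝ] ℝ)
    (fun x : U ↦ TangentSpace 𝓘(ℝ, F) x →L[ℝ] Bundle.Trivial U ℝ x) x₀) ⟨y, s y v⟩).2 w = s y v w
  rw [hom_trivializationAt_apply]
  simp only [ContinuousLinearMap.inCoordinates, ContinuousLinearMap.comp_apply]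
  rw [symmL_apply]
  simp
  rfl

end OpensSection

namespace InclusionEnd

variable (V : Opens E3) (R : ℝ) (hV : ∀ x : E3, R < ‖x‖ → x ∈ V)

/-- The open end `U = {y ∈ V | R < ‖y‖}` of an open subset `V ⊆ E3` containing
`{R < ‖x‖}` (as an open subset of `V`). Bartnik, CPAM 39 (1986), §1. [folklore] -/
def U : Opens V :=
  ⟨{y | R < ‖(y : E3)‖}, isOpen_lt continuous_const (continuous_norm.comp continuous_subtype_val)⟩

/-- Membership in `InclusionEnd.U` (Bartnik 1986, §1). [cite: Bartnik1986, §1] -/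
@[simp]
theorem mem_U {V : Opens E3} {R : ℝ} {y : V} : y ∈ U V R ↔ R < ‖(y : E3)‖ := Iff.rfl

include hV in
/-- The tautological bijection `U ≃ {x : E3 | R < ‖x‖}`, `y ↦ y` (both are the same subset of
`E3` since `{R < ‖x‖} ⊆ V`); both inverse laws hold by `rfl`. Bartnik 1986, §1. [cite: Bartnik1986, §1] -/
def chartEquiv : U V R ≃ exteriorRegion R where
  toFun y := ⟨y.1.1, y.2⟩
  invFun x := ⟨⟨x.1, hV x.1 x.2⟩, x.2⟩
  left_inv _ := rfl
  right_inv _ := rfl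

/-- The chart of an inclusion end is the identity on coordinates (Bartnik 1986, §1). [cite: Bartnik1986, §1] -/
@[simp]
theorem coe_chartEquiv (y : U V R) : (chartEquiv V R hV y : E3) = y := rfl

/-- The inverse chart of an inclusion end is the identity on coordinates (Bartnik 1986, §1). [cite: Bartnik1986, §1] -/
@[simp]
theorem coe_coe_chartEquiv_symm (x : exteriorRegion R) :
    (((chartEquiv V R hV).symm x : V) : E3) = x := rfl

/-- The chart of an inclusion end is smooth (it is the identity in the ambient coordinates of
two nested open submanifolds of `E3`: its composite with the inclusion into `E3` is the
composite of two open-submanifold inclusions, `ContMDiff.subtypeVal_comp_iff`). Bartnik 1986,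
§1; O'Neill 1983, Ch. 3, p. 57. [cite: Bartnik1986, §1] -/
theorem contMDiff_chartEquiv : ContMDiff (𝓡 3) (𝓡 3) ∞ (chartEquiv V R hV) := by
  have h : ContMDiff (𝓡 3) (𝓡 3) ∞ (fun y : U V R ↦ ((y : V) : E3)) :=
    contMDiff_subtype_val.comp contMDiff_subtype_val
  exact (ContMDiff.subtypeVal_comp_iff _ _).mp h

/-- The inverse chart of an inclusion end is smooth (identity in ambient coordinates: its
composite with the two inclusions `U ⊆ V ⊆ E3` is the inclusion of `exteriorRegion R`).
Bartnik 1986, §1; O'Neill 1983, Ch. 3, p. 57. [cite: Bartnik1986, §1] -/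
theorem contMDiff_chartEquiv_symm : ContMDiff (𝓡 3) (𝓡 3) ∞ (chartEquiv V R hV).symm :=
  (ContMDiff.subtypeVal_comp_iff _ _).mp <|
    (ContMDiff.subtypeVal_comp_iff _ _).mp contMDiff_subtype_val

/-- The chart `U ≅ {x : E3 | R < ‖x‖}` of an inclusion end as a diffeomorphism.
Bartnik 1986, §1. [cite: Bartnik1986, §1] -/
def chart : Diffeomorph (𝓡 3) (𝓡 3) (U V R) (exteriorRegion R) ∞ where
  toEquiv := chartEquiv V R hV
  contMDiff_toFun := contMDiff_chartEquiv V R hV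
  contMDiff_invFun := contMDiff_chartEquiv_symm V R hV

/-- An inclusion end is closed at infinity: for `R' > R` the set `{y ∈ V | R' ≤ ‖y‖}` (the image
of `chart⁻¹ {R' ≤ ‖x‖}`) is closed in `V`. Bartnik 1986, §1. [cite: Bartnik1986, §1] -/
theorem isClosed_far_chart (R' : ℝ) (hR' : R < R') :
    IsClosed (((↑) : U V R → V) '' (chart V R hV ⁻¹' {x | R' ≤ ‖(x : E3)‖})) := by
  have key : ((↑) : U V R → V) '' (chart V R hV ⁻¹' {x | R' ≤ ‖(x : E3)‖}) =
      {y : V | R' ≤ ‖(y : E3)‖} := by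
    ext y
    constructor
    · rintro ⟨z, hz, rfl⟩
      exact hz
    · intro hy
      exact ⟨⟨y, hR'.trans_le hy⟩, hy, rfl⟩
  rw [key]
  exact isClosed_le continuous_const (continuous_norm.comp continuous_subtype_val)

end InclusionEnd

/-- The **inclusion end** of an open subset `V ⊆ E3` containing the exterior region
`{R < ‖x‖}`, `R > 0`: `U = {y ∈ V | R < ‖y‖}` with the tautological chart onto
`exteriorRegion R` (open-end design of `AFEnd`). This is the end of flat data on `E3`, of the
isotropic Schwarzschild slices and (compare `Kerr.afEnd`) of the Kerr–Schild slices.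
Bartnik, CPAM 39 (1986), §1 (structure of infinity `Φ`). [folklore] -/
def inclusionAFEnd (V : Opens E3) (R : ℝ) (hR : 0 < R) (hV : ∀ x : E3, R < ‖x‖ → x ∈ V) :
    AFEnd V where
  U := InclusionEnd.U V R
  R := R
  R_pos := hR
  chart := InclusionEnd.chart V R hV
  isClosed_far := InclusionEnd.isClosed_far_chart V R hV

/-- The inner radius of an inclusion end (by `rfl`). Bartnik 1986, §1. [cite: Bartnik1986, §1] -/
@[simp]
theorem inclusionAFEnd_R (V : Opens E3) (R : ℝ) (hR : 0 < R)
    (hV : ∀ x : E3, R < ‖x‖ → x ∈ V) : (inclusionAFEnd V R hR hV).R = R := rfl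

/-! ### Minkowski: the slice `{t = 0}`, trivial data, the Minkowski development -/

namespace Minkowski

/-- The **Minkowski slice** `{t = 0} ≅ ℝ³`, as the open subset `⊤` of `E3` (an open submanifold
modelled on `𝓘(ℝ, E3) = 𝓡 3`; our own definition so that it carries its own `ConnectedSpace`
instance). Hawking–Ellis 1973, §5.1; Christodoulou–Klainerman 1993, §1. [cite: HawkingEllis1973, §5.1] -/
def slice : Opens E3 := ⊤

/-- Every point of `E3` lies in the Minkowski slice (it is all of `E3`). Hawking–Ellis 1973,
§5.1. [cite: HawkingEllis1973, §5.1] -/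
@[simp]
theorem mem_slice (y : E3) : y ∈ slice := trivial

/-- The Minkowski slice `E3` is connected (Hawking–Ellis 1973, §5.1). [cite: HawkingEllis1973, §5.1] -/
instance : ConnectedSpace slice :=
  isConnected_iff_connectedSpace.mp (by simpa [slice] using isConnected_univ (α := E3))

/-- The **slice embedding** `Minkowski.slice → E4`, `y ↦ (0, y)` (inclusion of `{t = 0}` into
Minkowski spacetime). Hawking–Ellis 1973, §5.1. [cite: HawkingEllis1973, §5.1] -/
def sliceEmbed : slice → E4 :=
  fun y ↦ E4.ofTimeSpace 0 y

/-- Unfolding lemma: `sliceEmbed y = (0, y)` (Hawking–Ellis 1973, §5.1). [cite: HawkingEllis1973, §5.1] -/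
@[simp]
theorem sliceEmbed_apply (y : slice) : sliceEmbed y = E4.ofTimeSpace 0 y := rfl

/-- The slice embedding is injective (Hawking–Ellis 1973, §5.1). [cite: HawkingEllis1973, §5.1] -/
theorem sliceEmbed_injective : Function.Injective sliceEmbed := fun _ _ h ↦
  Subtype.ext (E4.ofTimeSpace_injective 0 h)

/-- The **future unit normal** `∂ₜ` of the slice `{t = 0}` in Minkowski space (constant field
along `sliceEmbed`). Hawking–Ellis 1973, §5.1; Wald 1984, §10.2. [cite: HawkingEllis1973, §5.1] -/
def sliceNormal : NormalField 𝓘(ℝ, E4) sliceEmbed :=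
  fun _ ↦ E4.basisVector 0

/-- Unfolding lemma: `sliceNormal y = ∂ₜ` (Hawking–Ellis 1973, §5.1). [cite: HawkingEllis1973, §5.1] -/
@[simp]
theorem sliceNormal_apply (y : slice) : sliceNormal y = E4.basisVector 0 := rfl

/-- The unit ball `{v | ⟪v, v⟫ < 1}` of the Euclidean form on `T_y slice = E3` is von Neumann
bounded (transported from Mathlib's `riemannianMetricVectorSpace E3`). O'Neill 1983, Ch. 3,
p. 55. [cite: ONeill1983, Ch. 3  p. 55] -/
theorem isVonNBounded_inner_slice (y : slice) :
    Bornology.IsVonNBounded ℝ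
      {v : TangentSpace 𝓘(ℝ, E3) y | (innerSL ℝ (E := E3) : E3 →L[ℝ] E3 →L[ℝ] ℝ) v v < 1} :=
  (riemannianMetricVectorSpace E3).isVonNBounded y.1

/-- The constant section `y ↦ δ = innerSL ℝ` of the bundle of bilinear forms on `T slice` is
smooth (a constant section of a trivial bundle, `OpensSection.contMDiff_bilinSection`; compare
Mathlib's `riemannianMetricVectorSpace`). O'Neill 1983, Ch. 3, p. 55. [cite: ONeill1983, Ch. 3  p. 55] -/
theorem contMDiff_innerSL_slice :
    ContMDiff 𝓘(ℝ, E3) (𝓘(ℝ, E3).prod 𝓘(ℝ, E3 →L[ℝ] E3 →L[ℝ] ℝ)) ∞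
      (fun y : slice ↦ TotalSpace.mk' (E3 →L[ℝ] E3 →L[ℝ] ℝ)
        (E := fun x : slice ↦ TangentSpace 𝓘(ℝ, E3) x →L[ℝ] TangentSpace 𝓘(ℝ, E3) x →L[ℝ] ℝ)
        y (innerSL ℝ (E := E3) : E3 →L[ℝ] E3 →L[ℝ] ℝ)) :=
  OpensSection.contMDiff_bilinSection slice _ contMDiff_const

/-- The **flat metric** `δ` on the Minkowski slice as a smooth Riemannian metric on
`T slice`: `inner y := innerSL ℝ` on every fibre `T_y slice = E3`. O'Neill 1983, Ch. 3, p. 55;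
Christodoulou–Klainerman 1993, §1 (trivial data). [cite: ONeill1983, Ch. 3  p. 55] -/
def flatMetric : ContMDiffRiemannianMetric 𝓘(ℝ, E3) ∞ E3 (TangentSpace 𝓘(ℝ, E3) : slice → Type _)
    where
  inner _ := (innerSL ℝ (E := E3) : E3 →L[ℝ] E3 →L[ℝ] ℝ)
  symm _ v w := real_inner_comm (F := E3) w v
  pos _ _ hv := real_inner_self_pos (F := E3) |>.2 hv
  isVonNBounded := isVonNBounded_inner_slice
  contMDiff := contMDiff_innerSL_slice

/-- The flat metric at `y` is `δ = innerSL ℝ` (O'Neill 1983, Ch. 3, p. 55). [cite: ONeill1983, Ch. 3  p. 55] -/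
@[simp]
theorem flatMetric_inner (y : slice) :
    flatMetric.inner y = (innerSL ℝ (E := E3) : E3 →L[ℝ] E3 →L[ℝ] ℝ) := rfl

end Minkowski

/-- **gr.S17** (Minkowski; Schwarzschild `a = 0`; induced data. Hawking–Ellis 1973 §5.1;
Christodoulou–Klainerman 1993, §1; O'Neill 1995, Ch. 2). The **trivial initial data set**
`(ℝ³, δ, 0)` on the Minkowski slice `Minkowski.slice = ⊤ ⊆ E3`: `h = δ` (`innerSL ℝ` on every
fibre) and `k = 0`. It is the data induced by Minkowski spacetime on `{t = 0}`
(`Minkowski.development`) and the centre of the smallness condition of the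
Christodoulou–Klainerman stability theorem (gr.S07 downstream). [cite: HawkingEllis1973, §5.1] -/
def trivialData : InitialDataSet 𝓘(ℝ, E3) Minkowski.slice where
  h := Minkowski.flatMetric
  k _ := 0
  k_symm _ _ _ := rfl
  contMDiff_k := contMDiff_zero_bilinSection

/-- The metric of the trivial data at `y` is `δ` (Christodoulou–Klainerman 1993, §1). [cite: ChristodoulouKlainerman1993, §1] -/
@[simp]
theorem trivialData_h_inner (y : Minkowski.slice) :
    trivialData.h.inner y = (innerSL ℝ (E := E3) : E3 →L[ℝ] E3 →L[ℝ] ℝ) := rfl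

/-- The tensor `k` of the trivial data vanishes (Christodoulou–Klainerman 1993, §1). [cite: ChristodoulouKlainerman1993, §1] -/
@[simp]
theorem trivialData_k (y : Minkowski.slice) : trivialData.k y = 0 := rfl

/-- The trivial data are time-symmetric (`k = 0`). Bartnik–Isenberg 2004, §2. [cite: BartnikIsenberg2004, §2] -/
theorem trivialData_isTimeSymmetric : trivialData.IsTimeSymmetric := fun _ ↦ rfl

/-- The trivial data `(ℝ³, δ, 0)` solve the **vacuum constraint equations** (`R(δ) = 0`,
`k = 0`). Choquet-Bruhat 2009, Ch. VI, Thm. 3.3; Christodoulou–Klainerman 1993, §1. Named fact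
(D-0014); it binds the standing hypothesis `[trivialData.metric.HasLeviCivita]` of the
constraint functions (`InitialData.lean`), exactly as `Kerr.data_isVacuumConstraintSolution`. [cite: ChoquetBruhat2009, Ch. VI  Thm. 3.3] -/
def trivialData_isVacuumConstraintSolution : Prop :=
  ∀ [trivialData.metric.HasLeviCivita], trivialData.IsVacuumConstraintSolution

/-- The **asymptotically flat end** of the Minkowski slice: `U = {1 < ‖y‖}` with the
tautological chart onto `exteriorRegion 1` (`inclusionAFEnd`). Bartnik, CPAM 39 (1986), §1. [folklore] -/
def trivialAFEnd : AFEnd Minkowski.slice :=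
  inclusionAFEnd Minkowski.slice 1 one_pos fun x _ ↦ Minkowski.mem_slice x

/-- The inner radius of `trivialAFEnd` is `1` (by `rfl`). Bartnik 1986, §1. [cite: Bartnik1986, §1] -/
@[simp]
theorem trivialAFEnd_R : trivialAFEnd.R = 1 := rfl

/-- The trivial data are **strongly asymptotically flat in the sense of Christodoulou–Klainerman
with mass `0`**: `h − (1 + 0/r) δ = 0`, `k = 0` (in the chart of `trivialAFEnd`, which is the
identity in ambient coordinates, `hCoeff = δ` and `kCoeff = 0`, so every controlled quantity
vanishes identically). Christodoulou–Klainerman 1993, (1.0.9). Named fact (D-0014; the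
Mathlib-level identification of `mfderiv` of the inclusion chart with the identity is not
carried out here). [cite: ChristodoulouKlainerman1993, (1.0.9] -/
def trivialAFEnd_isStronglyAsymptoticallyFlatCK : Prop :=
  trivialAFEnd.IsStronglyAsymptoticallyFlatCK trivialData 0

/-- The trivial data have ADM energy `0` (all fluxes vanish: `∂h = 0`). Arnowitt–Deser–Misner
1962; Bartnik 1986, (4.2). Named fact (D-0014). [cite: Bartnik1986, (4.2] -/
def hasADMEnergy_trivialData : Prop :=
  trivialAFEnd.HasADMEnergy trivialData 0

/-- The ADM energy of the trivial data is `0` (from the named fact `hasADMEnergy_trivialData`,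
taken as the hypothesis `hE`). Bartnik 1986, (4.2). [cite: Bartnik1986, (4.2] -/
theorem admEnergy_trivialData (hE : hasADMEnergy_trivialData) :
    trivialAFEnd.admEnergy trivialData = 0 :=
  hE.admEnergy_eq

/-- The trivial data are complete (`(ℝ³, δ)` is geodesically complete: geodesics are affine
lines). O'Neill 1983, Ch. 3, Ex. 3.24 and Ch. 5, Thm. 5.21. Named fact (D-0014); it binds the
standing hypothesis `[trivialData.metric.HasLeviCivita]` of `InitialDataSet.IsComplete`. [cite: ONeill1983, Ch. 3  Ex. 3.24 and Ch. 5  Thm. 5.21] -/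
def isComplete_trivialData : Prop :=
  ∀ [trivialData.metric.HasLeviCivita], trivialData.IsComplete

namespace Minkowski

/-- The Minkowski metric `η` regarded as a `C^∞` Lorentzian metric on `E4`
(`Minkowski.metric.ofLE le_top`); this is by `rfl` the metric of the bundled
`Minkowski.spacetime` and the regularity at which developments and null infinity are stated.
O'Neill 1983, Ch. 3, p. 55. [cite: ONeill1983, Ch. 3  p. 55] -/
abbrev smoothMetric : LorentzianMetric 𝓘(ℝ, E4) ∞ E4 :=
  metric.ofLE le_top

/-- The metric of `Minkowski.spacetime` is `Minkowski.smoothMetric` (by `rfl`). O'Neill 1983,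
Ch. 5, Ex. 5.1. [cite: ONeill1983, Ch. 5  Ex. 5.1] -/
theorem spacetime_metric : spacetime.metric = smoothMetric := rfl

/-- The time orientation of `Minkowski.spacetime` is `∂ₜ` (by `rfl`). Hawking–Ellis 1973,
§5.1. [cite: HawkingEllis1973, §5.1] -/
theorem spacetime_timeOrientation :
    spacetime.timeOrientation = timeOrientation.ofLE le_top := rfl

/-- The value of the smooth Minkowski metric at any point is `η` (O'Neill 1983, Ch. 3, p. 55). [cite: ONeill1983, Ch. 3  p. 55] -/
@[simp]
theorem smoothMetric_val (x : E4) : smoothMetric.val x = bilin := rfl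

/-- The slice embedding `y ↦ (0, y)` is a smooth embedding of `Minkowski.slice` into `E4`
(affine-linear in coordinates). Hawking–Ellis 1973, §5.1; Lee, *Introduction to Smooth
Manifolds*, Thm. 4.12. Named fact (D-0014; the immersion half is Mathlib's chart notion, an
instance of the local immersion theorem), a field of `Minkowski.DevelopmentFacts`. [cite: HawkingEllis1973, §5.1] -/
def isSmoothEmbedding_sliceEmbed : Prop :=
  Manifold.IsSmoothEmbedding 𝓘(ℝ, E3) 𝓘(ℝ, E4) ∞ sliceEmbed

/-- The slice `{t = 0}` is a **Cauchy hypersurface** of Minkowski spacetime: every inextendible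
timelike curve meets it exactly once (the time coordinate is strictly monotone and unbounded
along inextendible timelike curves of `ℝ⁴₁`). Hawking–Ellis 1973, §5.1 and §6.5; O'Neill 1983,
Ch. 14, Ex. 14.9. Named fact (D-0014), a field of `Minkowski.DevelopmentFacts`. [cite: HawkingEllis1973, §5.1 and §6.5] -/
def isCauchySurface_range_sliceEmbed : Prop :=
  smoothMetric.IsCauchySurface (timeOrientation.ofLE le_top) (range sliceEmbed)

/-- `∂ₜ` is the future unit normal of `{t = 0}` in Minkowski spacetime: `η(∂ₜ, (0, v)) = 0`,
`η(∂ₜ, ∂ₜ) = −1`, and `∂ₜ` is the orienting field itself. Hawking–Ellis 1973, §5.1; Wald 1984,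
§10.2. Named fact (D-0014), a field of `Minkowski.DevelopmentFacts`. [cite: HawkingEllis1973, §5.1] -/
def isFutureUnitNormal_sliceNormal : Prop :=
  smoothMetric.IsFutureUnitNormal 𝓘(ℝ, E3) (timeOrientation.ofLE le_top) sliceEmbed sliceNormal

/-- The metric induced by `η` on `{t = 0}` is `δ`: `η((0, v), (0, w)) = ⟪v, w⟫`.
Hawking–Ellis 1973, §5.1; Wald 1984, (10.2.11). Named fact (D-0014; the point `y` is the
leading binder), a field of `Minkowski.DevelopmentFacts`. [cite: HawkingEllis1973, §5.1] -/
def pullbackBilin_sliceEmbed : Prop :=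
  ∀ y : slice,
    pullbackBilin (I := 𝓘(ℝ, E4)) (I' := 𝓘(ℝ, E3)) sliceEmbed smoothMetric.val y =
      trivialData.h.inner y

/-- The second fundamental form of `{t = 0}` in Minkowski spacetime w.r.t. `∂ₜ` vanishes
(`D ∂ₜ = 0` for the flat connection): `K_ν = 0 = k`. Wald 1984, (10.2.13); Hawking–Ellis 1973,
§5.1. Named fact (D-0014); it binds the standing Levi-Civita hypothesis
`[smoothMetric.HasLeviCivita]` of `secondFundamentalForm` (`Hypersurface.lean`) and the point
`y`, exactly as the field `Development.induced_k`; a field of `Minkowski.DevelopmentFacts`. [cite: Wald1984, (10.2.13] -/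
def secondFundamentalForm_sliceEmbed : Prop :=
  ∀ [smoothMetric.toPseudoRiemannianMetric.HasLeviCivita] (y : slice),
    smoothMetric.toPseudoRiemannianMetric.secondFundamentalForm 𝓘(ℝ, E3) sliceEmbed
      sliceNormal y = trivialData.kBilin y

/-- Minkowski space is Ricci-flat (indeed flat: the Levi-Civita connection of the constant
metric `η` is the trivial connection). O'Neill 1983, Ch. 3, p. 80; Wald 1984, §4.2. Named fact
(D-0014); it binds `[smoothMetric.HasLeviCivita]` exactly as the field
`VacuumDevelopment.isRicciFlat`; a field of `Minkowski.DevelopmentFacts`. [cite: ONeill1983, Ch. 3  p. 80] -/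
def isRicciFlat : Prop :=
  ∀ [smoothMetric.toPseudoRiemannianMetric.HasLeviCivita],
    smoothMetric.toPseudoRiemannianMetric.IsRicciFlat

/-- The differential-geometric facts about the slice `{t = 0}` of Minkowski space that are
vendored as named facts (D-0014) and on which the bundled vacuum development
`Minkowski.development` depends: `y ↦ (0, y)` is a smooth embedding (Lee, Thm. 4.12) with
Cauchy image (Hawking–Ellis 1973, §6.5), `∂ₜ` is its future unit normal, the induced metric is
`δ` and the second fundamental form is `0` (Wald 1984, (10.2.11)–(10.2.13)), and `η` is
Ricci-flat (O'Neill 1983, Ch. 3, p. 80). A `Prop`-valued class, taken as the instance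
hypothesis `[Minkowski.DevelopmentFacts]` by `Minkowski.development` and the statements about
it (house pattern: `Kerr.Facts`, `Kerr.SliceFacts`). [cite: HawkingEllis1973, §5.1 and §6.5; Wald 1984 (10.2.11)–(10.2.13)] -/
class DevelopmentFacts : Prop where
  /-- `y ↦ (0, y)` is a smooth embedding (named fact `Minkowski.isSmoothEmbedding_sliceEmbed`). -/
  isSmoothEmbedding_sliceEmbed : Minkowski.isSmoothEmbedding_sliceEmbed
  /-- `{t = 0}` is a Cauchy hypersurface (named fact `Minkowski.isCauchySurface_range_sliceEmbed`). -/
  isCauchySurface_range_sliceEmbed : Minkowski.isCauchySurface_range_sliceEmbed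
  /-- `∂ₜ` is the future unit normal (named fact `Minkowski.isFutureUnitNormal_sliceNormal`). -/
  isFutureUnitNormal_sliceNormal : Minkowski.isFutureUnitNormal_sliceNormal
  /-- The induced metric is `δ` (named fact `Minkowski.pullbackBilin_sliceEmbed`). -/
  pullbackBilin_sliceEmbed : Minkowski.pullbackBilin_sliceEmbed
  /-- The second fundamental form vanishes (named fact
  `Minkowski.secondFundamentalForm_sliceEmbed`). -/
  secondFundamentalForm_sliceEmbed : Minkowski.secondFundamentalForm_sliceEmbed
  /-- `η` is Ricci-flat (named fact `Minkowski.isRicciFlat`). -/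
  isRicciFlat : Minkowski.isRicciFlat

/-- **Minkowski spacetime as a vacuum development of the trivial data** `(ℝ³, δ, 0)`:
carrier `E4`, metric `η`, time orientation `∂ₜ` (`Minkowski.spacetime`), embedding
`y ↦ (0, y)`, future unit normal `∂ₜ`; the `Prop` fields are the named facts bundled in the
instance hypothesis `[Minkowski.DevelopmentFacts]` (`isSmoothEmbedding_sliceEmbed`,
`isCauchySurface_range_sliceEmbed`, `isFutureUnitNormal_sliceNormal`,
`pullbackBilin_sliceEmbed`, `secondFundamentalForm_sliceEmbed`, `isRicciFlat`).
Hawking–Ellis 1973, §5.1; Choquet-Bruhat–Geroch, CMP 14 (1969); Christodoulou–Klainerman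
1993, §1. [cite: HawkingEllis1973, §5.1] -/
def development [DevelopmentFacts] : VacuumDevelopment trivialData where
  toSpacetime := spacetime
  embed := sliceEmbed
  isSmoothEmbedding := DevelopmentFacts.isSmoothEmbedding_sliceEmbed
  isCauchySurface := DevelopmentFacts.isCauchySurface_range_sliceEmbed
  normal := sliceNormal
  isFutureUnitNormal := DevelopmentFacts.isFutureUnitNormal_sliceNormal
  induced_h := DevelopmentFacts.pullbackBilin_sliceEmbed
  induced_k := @DevelopmentFacts.secondFundamentalForm_sliceEmbed _
  isRicciFlat := @DevelopmentFacts.isRicciFlat _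

/-- The spacetime underlying the Minkowski development is `Minkowski.spacetime` (by `rfl`).
Hawking–Ellis 1973, §5.1. [cite: HawkingEllis1973, §5.1] -/
@[simp]
theorem development_toSpacetime [DevelopmentFacts] : development.toSpacetime = spacetime := rfl

/-- The embedding of the Minkowski development is `y ↦ (0, y)` (by `rfl`).
Hawking–Ellis 1973, §5.1. [cite: HawkingEllis1973, §5.1] -/
@[simp]
theorem development_embed [DevelopmentFacts] : development.embed = sliceEmbed := rfl

/-- The unit normal of the Minkowski development is `∂ₜ` (by `rfl`). Hawking–Ellis 1973, §5.1. [cite: HawkingEllis1973, §5.1] -/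
@[simp]
theorem development_normal [DevelopmentFacts] : development.normal = sliceNormal := rfl

/-- **Minkowski spacetime is the maximal globally hyperbolic vacuum development of the trivial
data**: every vacuum development of `(ℝ³, δ, 0)` embeds isometrically into `(ℝ⁴, η)` compatibly
with `{t = 0}` (Minkowski space is globally hyperbolic with Cauchy surface `{t = 0}` and
geodesically complete, hence inextendible as a globally hyperbolic development).
Choquet-Bruhat–Geroch, CMP 14 (1969), Theorem p. 331; Ringström 2009, Thm. 16.6 and Ch. 18.
Named fact (D-0014), under `[Minkowski.DevelopmentFacts]`. [cite: Ringstrom2009, Thm. 16.6 and Ch. 18] -/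
def development_isMaximal [DevelopmentFacts] : Prop :=
  development.IsMaximal

end Minkowski

/-- **Sanity statement (mandatory, Outline §4.2 test table, Minkowski column ✓).** The Minkowski
development of the trivial data has **complete future null infinity** in Christodoulou's
intrinsic (sojourn) sense: Minkowski space is null geodesically complete, so every normalised
future null ray from `{t = 0}` is future complete
(`hasCompleteFutureNullInfinity_of_isNullGeodesicallyComplete`). Christodoulou, CQG 16 (1999)
A23, p. A27; Dafermos–Rodnianski, arXiv:0811.0354, §2.6.2. Named fact (D-0014), under
`[Minkowski.DevelopmentFacts]` (`Development.HasCompleteFutureNullInfinity` itself binds the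
Levi-Civita hypothesis). [cite: arXiv08110354] -/
def minkowski_hasCompleteFutureNullInfinity [Minkowski.DevelopmentFacts] : Prop :=
  Minkowski.development.toDevelopment.HasCompleteFutureNullInfinity

namespace Kerr

/-- The **closed far region** `{y : E3 | R + 1 ≤ ‖y‖}`, `R = Kerr.afRadius a r₀`, of the
Kerr–Schild slice: a closed subset of `E3` contained in `Kerr.slice a r₀`
(`Kerr.mem_slice_of_lt_norm`) whose only end is the asymptotically flat one (its compact
subsets exhaust it by the shells `{R + 1 ≤ ‖y‖ ≤ R'}`). It is the set of ray origins in the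
Kerr sanity statement `kerr_hasCompleteFutureNullInfinity`. Dafermos–Rodnianski,
arXiv:0811.0354, §5.1; Bartnik 1986, §1. [cite: Bartnik1986, §1] -/
def farSlice (a r₀ : ℝ) : Set E3 := {y | afRadius a r₀ + 1 ≤ ‖y‖}

/-- Membership in the closed far region (Bartnik 1986, §1). [cite: Bartnik1986, §1] -/
@[simp]
theorem mem_farSlice {a r₀ : ℝ} {y : E3} : y ∈ farSlice a r₀ ↔ afRadius a r₀ + 1 ≤ ‖y‖ :=
  Iff.rfl

/-- The closed far region is closed in `E3` (Bartnik 1986, §1). [cite: Bartnik1986, §1] -/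
theorem isClosed_farSlice (a r₀ : ℝ) : IsClosed (farSlice a r₀) :=
  isClosed_le continuous_const continuous_norm

/-- Points of the closed far region lie in the Kerr–Schild slice (`R + 1 ≤ ‖y‖` gives
`R < ‖y‖`, then `Kerr.mem_slice_of_lt_norm`). Dafermos–Rodnianski arXiv:0811.0354, §5.1. [cite: arXiv08110354] -/
theorem mem_slice_of_mem_farSlice {a r₀ : ℝ} {y : E3} (hy : y ∈ farSlice a r₀) :
    y ∈ slice a r₀ :=
  mem_slice_of_lt_norm (by rw [mem_farSlice] at hy; linarith)

/-- The inclusion of the closed far region into the Kerr–Schild slice.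
Dafermos–Rodnianski arXiv:0811.0354, §5.1. [cite: arXiv08110354] -/
def farSliceIncl (a r₀ : ℝ) : farSlice a r₀ → slice a r₀ :=
  fun y ↦ ⟨y, mem_slice_of_mem_farSlice y.2⟩

/-- The inclusion of the closed far region is the identity on coordinates
(Dafermos–Rodnianski arXiv:0811.0354, §5.1). [cite: arXiv08110354] -/
@[simp]
theorem coe_farSliceIncl (a r₀ : ℝ) (y : farSlice a r₀) : (farSliceIncl a r₀ y : E3) = y := rfl

/-- The embedding `y ↦ (0, y)` of the closed far region into the Kerr chart
(`Kerr.sliceEmbed ∘ Kerr.farSliceIncl`). Dafermos–Rodnianski arXiv:0811.0354, §5.1. [cite: arXiv08110354] -/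
def farSliceEmbed (a r₀ : ℝ) : farSlice a r₀ → region a r₀ :=
  fun y ↦ sliceEmbed a r₀ (farSliceIncl a r₀ y)

/-- Unfolding lemma: `farSliceEmbed a r₀ y = (0, y)` in `E4`
(Dafermos–Rodnianski arXiv:0811.0354, §5.1). [cite: arXiv08110354] -/
@[simp]
theorem coe_farSliceEmbed (a r₀ : ℝ) (y : farSlice a r₀) :
    (farSliceEmbed a r₀ y : E4) = E4.ofTimeSpace 0 y := rfl

/-- The future unit normal of the slice along the closed far region (`Kerr.sliceNormal`
restricted; a purely coordinate expression, independent of `[Kerr.Facts]`). Cook, Living Rev.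
Relativ. 3 (2000) 5, §3.2.2. [folklore] -/
def farSliceNormal (M a r₀ : ℝ) : NormalField 𝓘(ℝ, E4) (farSliceEmbed a r₀) :=
  fun y ↦ sliceNormal M a r₀ (farSliceIncl a r₀ y)

/-- Unfolding lemma for `Kerr.farSliceNormal` (Cook 2000, §3.2.2). [cite: Cook2000, §3.2.2] -/
@[simp]
theorem farSliceNormal_apply (M a r₀ : ℝ) (y : farSlice a r₀) :
    farSliceNormal M a r₀ y = sliceNormal M a r₀ (farSliceIncl a r₀ y) := rfl

end Kerr

/-- **Sanity statement (Outline §4.2 test table, Kerr column ✓).** For `M ≥ 0` and any `a, r₀`,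
the Kerr chart `(Kerr.region a r₀, g_{M,a})`, time-oriented by `−g♯dt*`, viewed from the closed
far region `{R + 1 ≤ ‖y‖}` of the Kerr–Schild slice `{t* = 0}` with its future unit normal, has
**complete future null infinity in the sojourn sense**: outgoing null rays are future complete
(`r → ∞` with unbounded affine parameter), and an infalling ray starting at coordinate radius
`R₁` enters `J⁺(ι B₀)`, `B₀ = {R + 1 ≤ ‖y‖ ≤ R + 2}`, at radius `≈ (R₁ + R)/2` and can leave the
chart through `{r = max r₀ 0}` (or run into `r → 0`) only after affine time
`≳ (R₁ + R)/2 − r₀ → ∞` as `R₁ → ∞` (`|dr/dλ| ≤ E ≈ 1` for the normalised parameter).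

*Why the closed far region and not all of `Kerr.slice`* (deviation from the outline,
documented): `HasCompleteFutureNullInfinity` quantifies over ray origins outside a *compact*
subset of the data manifold; `Kerr.slice a r₀ = {r > max r₀ 0}` has, besides the asymptotically
flat end, an inner coordinate edge `{r = max r₀ 0}` (or the puncture), near which ingoing rays
leave the chart after arbitrarily short affine time, so the literal statement on `Kerr.slice`
is false for every `M, a, r₀` — an artefact of the chart domain, not of Kerr's null infinity.
Restricting the origins to the closed far region (whose only end is infinity) gives the true
sanity statement. Dafermos–Rodnianski, arXiv:0811.0354, §2.6.2 and §5.1; Christodoulou, CQG 16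
(1999) A23, p. A27. Named fact (D-0014); `[Kerr.Facts]` (the metric, `KerrSchild`) is an
instance hypothesis, `0 ≤ M` (time orientation) and the standing Levi-Civita hypothesis
`[(Kerr.smoothMetric M a r₀).HasLeviCivita]` of the null-ray notions (`NullInfinity`; supplied
by `Kerr.hasLeviCivita_smoothMetric` under `[Kerr.SliceFacts]`) are leading binders. [cite: arXiv08110354] -/
def kerr_hasCompleteFutureNullInfinity [Kerr.Facts] (M a r₀ : ℝ) : Prop :=
  ∀ (hM : 0 ≤ M) [(Kerr.smoothMetric M a r₀).HasLeviCivita],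
    (Kerr.smoothMetric M a r₀).HasCompleteFutureNullInfinity
      ((Kerr.timeOrientation M a r₀ hM).ofLE le_top) (Kerr.farSliceEmbed a r₀)
      (Kerr.farSliceNormal M a r₀)

/-! ### Time-symmetric Schwarzschild data in isotropic coordinates -/

namespace Schwarzschild

/-- The **isotropic conformal factor** `ψ(y) = 1 + M / (2‖y‖)` of the time-symmetric
Schwarzschild slice: `h = ψ⁴ δ` on `E3 ∖ {0}`. Total on `E3` with the junk value `ψ(0) = 1`
(`M / 0 = 0`); only used on open sets not containing `0`. Misner–Thorne–Wheeler 1973, (31.22);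
Bray, J. Diff. Geom. 59 (2001), §1; Huisken–Ilmanen, J. Diff. Geom. 59 (2001), §1. [cite: MisnerThorneWheeler1973, (31.22] -/
def conformalFactor (M : ℝ) (y : E3) : ℝ := 1 + M / (2 * ‖y‖)

/-- Unfolding lemma for the conformal factor (MTW 1973, (31.22)). [cite: MTW1973, (31.22] -/
theorem conformalFactor_apply (M : ℝ) (y : E3) : conformalFactor M y = 1 + M / (2 * ‖y‖) := rfl

/-- For `M ≥ 0` the conformal factor satisfies `1 ≤ ψ` (MTW 1973, (31.22)). [cite: MTW1973, (31.22] -/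
theorem one_le_conformalFactor {M : ℝ} (hM : 0 ≤ M) (y : E3) : 1 ≤ conformalFactor M y := by
  unfold conformalFactor
  have : 0 ≤ M / (2 * ‖y‖) := by positivity
  linarith

/-- For `M ≥ 0` the conformal factor is positive (MTW 1973, (31.22)). [cite: MTW1973, (31.22] -/
theorem conformalFactor_pos {M : ℝ} (hM : 0 ≤ M) (y : E3) : 0 < conformalFactor M y :=
  one_pos.trans_le (one_le_conformalFactor hM y)

/-- At the throat `‖y‖ = M/2` (`M ≠ 0`) the conformal factor equals `2` (MTW 1973, (31.22);
Bray 2001, §1). [cite: MTW1973, (31.22] -/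
theorem conformalFactor_of_norm_eq {M : ℝ} (hM : M ≠ 0) {y : E3} (hy : ‖y‖ = M / 2) :
    conformalFactor M y = 2 := by
  rw [conformalFactor, hy, mul_div_cancel₀ M two_ne_zero, div_self hM]
  norm_num

/-- The conformal factor is smooth away from the origin (`‖·‖` is smooth on `E3 ∖ {0}`).
MTW 1973, (31.22). [cite: MTW1973, (31.22] -/
theorem contDiffOn_conformalFactor (M : ℝ) :
    ContDiffOn ℝ ∞ (conformalFactor M) {y : E3 | y ≠ 0} := by
  intro y hy
  have h : ContDiffAt ℝ ∞ (fun y : E3 ↦ ‖y‖) y := contDiffAt_norm ℝ hy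
  have h2 : (2 : ℝ) * ‖y‖ ≠ 0 := mul_ne_zero two_ne_zero (norm_ne_zero_iff.mpr hy)
  exact (contDiffAt_const.add (contDiffAt_const.div (contDiffAt_const.mul h) h2)).contDiffWithinAt

variable (M : ℝ) (U : Opens E3)

/-- The **conformally flat form** `h_y = ψ(y)⁴ δ` on the fibre `T_y U = E3` (MTW 1973, (31.22);
Bray 2001, (1)). [cite: MTW1973, (31.22] -/
def conformalInner (y : U) : TangentSpace 𝓘(ℝ, E3) y →L[ℝ] TangentSpace 𝓘(ℝ, E3) y →L[ℝ] ℝ :=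
  show E3 →L[ℝ] E3 →L[ℝ] ℝ from conformalFactor M (y : E3) ^ 4 • (innerSL ℝ (E := E3))

/-- `h_y(v, w) = ψ(y)⁴ ⟪v, w⟫` (MTW 1973, (31.22)). [cite: MTW1973, (31.22] -/
@[simp]
theorem conformalInner_apply (y : U) (v w : E3) :
    conformalInner M U y v w = conformalFactor M (y : E3) ^ 4 * ⟪v, w⟫_ℝ := rfl

/-- `h = ψ⁴ δ` is symmetric (MTW 1973, (31.22)). [cite: MTW1973, (31.22] -/
theorem conformalInner_symm (y : U) (v w : TangentSpace 𝓘(ℝ, E3) y) :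
    conformalInner M U y v w = conformalInner M U y w v := by
  change conformalFactor M (y : E3) ^ 4 * @inner ℝ E3 _ v w =
    conformalFactor M (y : E3) ^ 4 * @inner ℝ E3 _ w v
  rw [real_inner_comm]

variable {M} in
/-- For `M ≥ 0`, `h = ψ⁴ δ` is positive definite (`ψ ≥ 1 > 0`; this is where `0 ≤ M` is used).
MTW 1973, (31.22); Bray 2001, §1. [cite: MTW1973, (31.22] -/
theorem conformalInner_pos (hM : 0 ≤ M) (y : U) (v : TangentSpace 𝓘(ℝ, E3) y) (hv : v ≠ 0) :
    0 < conformalInner M U y v v := by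
  change 0 < conformalFactor M (y : E3) ^ 4 * @inner ℝ E3 _ v v
  exact mul_pos (pow_pos (conformalFactor_pos hM _) 4) (real_inner_self_pos (F := E3) |>.2 hv)

variable {M} in
/-- For `M ≥ 0` the unit ball `{v | ψ⁴ ⟪v, v⟫ < 1}` of `h_y` is von Neumann bounded: it is
contained in the Euclidean unit ball since `ψ⁴ ≥ 1`. MTW 1973, (31.22). [cite: MTW1973, (31.22] -/
theorem isVonNBounded_conformalInner (hM : 0 ≤ M) (y : U) :
    Bornology.IsVonNBounded ℝ {v : TangentSpace 𝓘(ℝ, E3) y | conformalInner M U y v v < 1} := by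
  refine ((riemannianMetricVectorSpace E3).isVonNBounded y.1).subset fun v hv ↦ ?_
  change conformalFactor M (y : E3) ^ 4 * @inner ℝ E3 _ v v < 1 at hv
  change @inner ℝ E3 _ v v < 1
  refine lt_of_le_of_lt ?_ hv
  exact le_mul_of_one_le_left real_inner_self_nonneg
    (one_le_pow₀ (one_le_conformalFactor hM _))

/-- If `0 ∉ U`, the section `y ↦ ψ(y)⁴ δ` of the bundle of bilinear forms on `TU` is smooth
(`ψ` is smooth on `E3 ∖ {0} ⊇ U`, `contDiffOn_conformalFactor`, and sections over an open subset
of `E3` are smooth iff their values are, `OpensSection.contMDiff_bilinSection`). True for every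
real `M`. MTW 1973, (31.22). [cite: MTW1973, (31.22] -/
theorem contMDiff_conformalInner (hU : (0 : E3) ∉ (U : Set E3)) :
    ContMDiff 𝓘(ℝ, E3) (𝓘(ℝ, E3).prod 𝓘(ℝ, E3 →L[ℝ] E3 →L[ℝ] ℝ)) ∞
      (fun y : U ↦ TotalSpace.mk' (E3 →L[ℝ] E3 →L[ℝ] ℝ)
        (E := fun x : U ↦ TangentSpace 𝓘(ℝ, E3) x →L[ℝ] TangentSpace 𝓘(ℝ, E3) x →L[ℝ] ℝ)
        y (conformalInner M U y)) := by
  refine OpensSection.contMDiff_bilinSection U (fun y ↦ conformalInner M U y) ?_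
  have h : ContDiffOn ℝ ∞ (fun y : E3 ↦
      show E3 →L[ℝ] E3 →L[ℝ] ℝ from conformalFactor M y ^ 4 • innerSL ℝ (E := E3)) {y | y ≠ 0} :=
    contDiffOn_smul_const' ((contDiffOn_conformalFactor M).pow 4) _
  have hU' : ∀ y : U, (y : E3) ∈ {y : E3 | y ≠ 0} := fun y h0 ↦ hU (h0 ▸ y.2)
  exact h.contMDiffOn.comp_contMDiff contMDiff_subtype_val hU'

variable {M} in
/-- The conformally flat metric `h = ψ⁴ δ`, `ψ = 1 + M/(2r)`, `M ≥ 0`, as a smooth Riemannian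
metric on an open `U ⊆ E3` with `0 ∉ U`. MTW 1973, (31.22); Bray, J. Diff. Geom. 59 (2001),
(1). [cite: MTW1973, (31.22] -/
def conformalMetric (hM : 0 ≤ M) (hU : (0 : E3) ∉ (U : Set E3)) :
    ContMDiffRiemannianMetric 𝓘(ℝ, E3) ∞ E3 (TangentSpace 𝓘(ℝ, E3) : U → Type _) where
  inner := conformalInner M U
  symm := conformalInner_symm M U
  pos := conformalInner_pos U hM
  isVonNBounded := isVonNBounded_conformalInner U hM
  contMDiff := contMDiff_conformalInner M U hU

variable {M} in
/-- The **time-symmetric conformally flat Schwarzschild data** `(U, ψ⁴ δ, 0)`,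
`ψ = 1 + M/(2‖y‖)`, `M ≥ 0`, on an open `U ⊆ E3` not containing the origin (isotropic
coordinates of the `{t = 0}` slice of Schwarzschild). Misner–Thorne–Wheeler 1973, (31.22);
Bray, J. Diff. Geom. 59 (2001), §1; Huisken–Ilmanen, J. Diff. Geom. 59 (2001), §1. [cite: MisnerThorneWheeler1973, (31.22] -/
def conformalData (hM : 0 ≤ M) (hU : (0 : E3) ∉ (U : Set E3)) : InitialDataSet 𝓘(ℝ, E3) U where
  h := conformalMetric U hM hU
  k _ := 0
  k_symm _ _ _ := rfl
  contMDiff_k := contMDiff_zero_bilinSection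

variable {M U}

/-- The metric of the conformal data at `y` is `ψ(y)⁴ δ` (MTW 1973, (31.22)). [cite: MTW1973, (31.22] -/
@[simp]
theorem conformalData_h_inner (hM : 0 ≤ M) (hU : (0 : E3) ∉ (U : Set E3)) (y : U) :
    (conformalData U hM hU).h.inner y = conformalInner M U y := rfl

/-- The tensor `k` of the conformal data vanishes (time symmetry; Bray 2001, §1). [cite: Bray2001, §1] -/
@[simp]
theorem conformalData_k (hM : 0 ≤ M) (hU : (0 : E3) ∉ (U : Set E3)) (y : U) :
    (conformalData U hM hU).k y = 0 := rfl

/-- The conformal Schwarzschild data are time-symmetric (`k = 0`). Bray 2001, §1;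
Bartnik–Isenberg 2004, §2. [cite: Bray2001, §1] -/
theorem conformalData_isTimeSymmetric (hM : 0 ≤ M) (hU : (0 : E3) ∉ (U : Set E3)) :
    (conformalData U hM hU).IsTimeSymmetric := fun _ ↦ rfl

/-- The conformal Schwarzschild data solve the **vacuum constraint equations**: `k = 0` and
`R(ψ⁴ δ) = −8 ψ⁻⁵ Δ_δ ψ = 0` since `ψ = 1 + M/(2r)` is `δ`-harmonic on `E3 ∖ {0}`.
Bray, J. Diff. Geom. 59 (2001), §1; Bartnik–Isenberg 2004, §3 (Lichnerowicz equation);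
Choquet-Bruhat 2009, Ch. VII, §3. Named fact (D-0014; `0 ≤ M`, `0 ∉ U` and the standing
hypothesis `[(conformalData U hM hU).metric.HasLeviCivita]` of the constraint functions are
leading binders). [cite: BartnikIsenberg2004, §3 (Lichnerowicz equation] -/
def conformalData_isVacuumConstraintSolution : Prop :=
  ∀ (hM : 0 ≤ M) (hU : (0 : E3) ∉ (U : Set E3)) [(conformalData U hM hU).metric.HasLeviCivita],
    (conformalData U hM hU).IsVacuumConstraintSolution

/-! #### The punctured slice and the isotropic exterior -/

/-- The **punctured slice** `E3 ∖ {0} = {y | 0 < ‖y‖}` carrying the complete two-ended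
time-symmetric Schwarzschild data (`M > 0`). Misner–Thorne–Wheeler 1973, §31.7;
Brill–Lindquist, Phys. Rev. 131 (1963). [cite: MisnerThorneWheeler1973, §31.7] -/
def puncturedSlice : Opens E3 :=
  ⟨{y | 0 < ‖y‖}, isOpen_lt continuous_const continuous_norm⟩

/-- Membership in the punctured slice (MTW 1973, §31.7). [cite: MTW1973, §31.7] -/
@[simp]
theorem mem_puncturedSlice {y : E3} : y ∈ puncturedSlice ↔ 0 < ‖y‖ := Iff.rfl

/-- The origin is not in the punctured slice (MTW 1973, §31.7). [cite: MTW1973, §31.7] -/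
theorem zero_notMem_puncturedSlice : (0 : E3) ∉ (puncturedSlice : Set E3) := by
  simp [puncturedSlice]

/-- The punctured slice `ℝ³ ∖ {0}` is (nonempty and) connected (Mathlib's
`isConnected_compl_singleton_of_one_lt_rank`, `rank ℝ³ = 3 > 1`). MTW 1973, §31.7. [cite: MTW1973, §31.7] -/
theorem isConnected_puncturedSlice : IsConnected (puncturedSlice : Set E3) := by
  have hset : (puncturedSlice : Set E3) = {(0 : E3)}ᶜ := by
    ext y
    simp [puncturedSlice]
  rw [hset]
  refine isConnected_compl_singleton_of_one_lt_rank ?_ 0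
  rw [← Module.finrank_eq_rank, finrank_euclideanSpace_fin]
  norm_num

/-- The punctured slice is a connected space (from `isConnected_puncturedSlice`).
MTW 1973, §31.7. [cite: MTW1973, §31.7] -/
instance : ConnectedSpace puncturedSlice :=
  isConnected_iff_connectedSpace.mp isConnected_puncturedSlice

variable (M) in
/-- The **isotropic exterior** `{y | M/2 < ‖y‖}` of the throat `‖y‖ = M/2` of the
time-symmetric Schwarzschild slice (`= exteriorRegion (M/2)`; for `M ≤ 0` it contains all of
`E3 ∖ {0}`, for `M < 0` all of `E3`). This is the model of the rigidity case of the Riemannian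
Penrose inequality. Bray, J. Diff. Geom. 59 (2001), Thm. 1; Huisken–Ilmanen, J. Diff. Geom. 59
(2001), Main Theorem. [folklore] -/
def isotropicExterior : Opens E3 := exteriorRegion (M / 2)

/-- Membership in the isotropic exterior (Bray 2001, §1). [cite: Bray2001, §1] -/
@[simp]
theorem mem_isotropicExterior {y : E3} : y ∈ isotropicExterior M ↔ M / 2 < ‖y‖ := Iff.rfl

/-- For `M ≥ 0` the origin is not in the isotropic exterior (`¬ M/2 < ‖0‖ = 0`).
Bray 2001, §1. [cite: Bray2001, §1] -/
theorem zero_notMem_isotropicExterior (hM : 0 ≤ M) :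
    (0 : E3) ∉ (isotropicExterior M : Set E3) := by
  simp only [SetLike.mem_coe, mem_isotropicExterior, norm_zero, not_lt]
  linarith

/-- The isotropic exterior `{M/2 < ‖y‖}` is nonempty and connected for every real `M` (the
exterior of a closed ball in `ℝ³` — the continuous image `(u, t) ↦ t u` of the connected set
`S² × (M/2, ∞)` (Mathlib's `isConnected_sphere`, `rank ℝ³ = 3 > 1`) — or all of `ℝ³`).
Bray 2001, §1. [cite: Bray2001, §1] -/
theorem isConnected_isotropicExterior (M : ℝ) : IsConnected (isotropicExterior M : Set E3) := by
  rcases lt_or_ge (M / 2) 0 with hM | hM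
  · have huniv : (isotropicExterior M : Set E3) = univ :=
      eq_univ_of_forall fun y ↦ hM.trans_le (norm_nonneg y)
    rw [huniv]
    exact isConnected_univ
  · have hrank : 1 < Module.rank ℝ E3 := by
      rw [← Module.finrank_eq_rank, finrank_euclideanSpace_fin]
      norm_num
    have hc : IsConnected ((Metric.sphere (0 : E3) 1) ×ˢ Ioi (M / 2)) :=
      (isConnected_sphere hrank 0 zero_le_one).prod isConnected_Ioi
    have himg : (fun p : E3 × ℝ ↦ p.2 • p.1) '' ((Metric.sphere (0 : E3) 1) ×ˢ Ioi (M / 2)) =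
        (isotropicExterior M : Set E3) := by
      ext z
      simp only [mem_image, mem_prod, mem_sphere_iff_norm, sub_zero, mem_Ioi, SetLike.mem_coe,
        mem_isotropicExterior, Prod.exists]
      constructor
      · rintro ⟨u, t, ⟨hu, ht⟩, rfl⟩
        rwa [norm_smul, hu, mul_one, Real.norm_of_nonneg (hM.trans ht.le)]
      · intro hz
        have hz0 : z ≠ 0 := fun h ↦ by rw [h, norm_zero] at hz; linarith
        have hnz : ‖z‖ ≠ 0 := norm_ne_zero_iff.mpr hz0
        refine ⟨‖z‖⁻¹ • z, ‖z‖, ⟨?_, hz⟩, ?_⟩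
        · rw [norm_smul, norm_inv, norm_norm, inv_mul_cancel₀ hnz]
        · rw [smul_smul, mul_inv_cancel₀ hnz, one_smul]
    rw [← himg]
    exact hc.image _ (continuous_snd.smul continuous_fst).continuousOn

/-- The isotropic exterior is a connected space (from `isConnected_isotropicExterior`).
Bray 2001, §1. [cite: Bray2001, §1] -/
instance (M : ℝ) : ConnectedSpace (isotropicExterior M) :=
  isConnected_iff_connectedSpace.mp (isConnected_isotropicExterior M)

/-- **gr.S17** (Minkowski; Schwarzschild `a = 0`; induced data. Misner–Thorne–Wheeler 1973,
(31.22) and §31.7; Brill–Lindquist, Phys. Rev. 131 (1963); Bray, J. Diff. Geom. 59 (2001), §1).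
The **time-symmetric Schwarzschild data** `(E3 ∖ {0}, (1 + M/(2r))⁴ δ, 0)`, `M ≥ 0`, in
isotropic coordinates: the data induced on the totally geodesic slice `{t = 0}` of (Kruskal)
Schwarzschild. For `M > 0` it is complete and two-ended (the inversion `y ↦ (M/2)² y/‖y‖²` is
an isometry exchanging the ends) with minimal throat `‖y‖ = M/2` of area `16π M²`; for `M = 0`
it is flat punctured `ℝ³`. (The *ingoing* Kerr–Schild Schwarzschild slice, not time-symmetric,
is `Kerr.data M 0 r₀`.) [cite: MisnerThorneWheeler1973, (31.22] -/
def timeSymmetricData (M : ℝ) (hM : 0 ≤ M) : InitialDataSet 𝓘(ℝ, E3) puncturedSlice :=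
  conformalData puncturedSlice hM zero_notMem_puncturedSlice

/-- The **time-symmetric Schwarzschild exterior data** `({M/2 < ‖y‖}, (1 + M/(2r))⁴ δ, 0)`,
`M ≥ 0`: the open exterior of the minimal throat, i.e. the region exterior to the outermost
minimal surface — the rigidity model of the Riemannian Penrose inequality. Bray, J. Diff.
Geom. 59 (2001), Thm. 1; Huisken–Ilmanen, J. Diff. Geom. 59 (2001), Main Theorem. [folklore] -/
def timeSymmetricExteriorData (M : ℝ) (hM : 0 ≤ M) :
    InitialDataSet 𝓘(ℝ, E3) (isotropicExterior M) :=
  conformalData (isotropicExterior M) hM (zero_notMem_isotropicExterior hM)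

/-- The exterior data are the restriction of the two-ended data to `{M/2 < ‖y‖}` (same
formula on a smaller open set): the metrics agree pointwise. Bray 2001, §1. [cite: Bray2001, §1] -/
theorem timeSymmetricExteriorData_h_inner (M : ℝ) (hM : 0 ≤ M) (y : isotropicExterior M)
    (v w : E3) :
    (timeSymmetricExteriorData M hM).h.inner y v w =
      conformalFactor M (y : E3) ^ 4 * ⟪v, w⟫_ℝ := rfl

/-- The **asymptotically flat end** of the isotropic exterior: `U = {M/2 + 1 < ‖y‖}` with the
tautological chart (`inclusionAFEnd`, `R = M/2 + 1 > 0` for `M ≥ 0`). Bartnik, CPAM 39 (1986),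
§1; Bray 2001, §1. [cite: Bray2001, §1] -/
def afEnd (M : ℝ) (hM : 0 ≤ M) : AFEnd (isotropicExterior M) :=
  inclusionAFEnd (isotropicExterior M) (M / 2 + 1) (by linarith) fun x hx ↦ by
    simp only [mem_isotropicExterior]
    linarith

/-- The inner radius of `Schwarzschild.afEnd` is `M/2 + 1` (by `rfl`). Bartnik 1986, §1. [cite: Bartnik1986, §1] -/
@[simp]
theorem afEnd_R (M : ℝ) (hM : 0 ≤ M) : (afEnd M hM).R = M / 2 + 1 := rfl

/-- The time-symmetric Schwarzschild exterior data are asymptotically flat of order `1`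
(`ψ⁴ − 1 = 2M/r + O(r⁻²)` with all derivatives). Bartnik 1986, Def. 2.1; Bray 2001, §1. Named
fact (D-0014; `0 ≤ M` is the leading binder). [cite: Bartnik1986, Def. 2.1] -/
def isAsymptoticallyFlat_timeSymmetricExteriorData (M : ℝ) : Prop :=
  ∀ hM : 0 ≤ M, (afEnd M hM).IsAsymptoticallyFlat (timeSymmetricExteriorData M hM) 1

/-- The time-symmetric Schwarzschild exterior data have **ADM energy `M`**:
`h_ij = (1 + 2M/r) δ_ij + O(r⁻²)`, so `∑ (∂ⱼ h_ij − ∂ᵢ h_jj) xⁱ/r = 4M/r² + O(r⁻³)` with flux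
`→ 16π M`. Arnowitt–Deser–Misner 1962; Bartnik 1986, (4.2); Bray 2001, §1. Named fact (D-0014;
`0 ≤ M` is the leading binder). [cite: ArnowittDeserMisner1962] -/
def hasADMEnergy_timeSymmetricExteriorData (M : ℝ) : Prop :=
  ∀ hM : 0 ≤ M, (afEnd M hM).HasADMEnergy (timeSymmetricExteriorData M hM) M

/-- The ADM energy of the time-symmetric Schwarzschild exterior data is `M` (from the named
fact `hasADMEnergy_timeSymmetricExteriorData`, taken as the hypothesis `hE`).
Bartnik 1986, (4.2). [cite: Bartnik1986, (4.2] -/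
theorem admEnergy_timeSymmetricExteriorData (M : ℝ) (hM : 0 ≤ M)
    (hE : hasADMEnergy_timeSymmetricExteriorData M) :
    (afEnd M hM).admEnergy (timeSymmetricExteriorData M hM) = M :=
  (hE hM).admEnergy_eq

/-- For `M > 0` the two-ended time-symmetric Schwarzschild data `(E3 ∖ {0}, ψ⁴ δ)` are
**complete**: near the puncture `ψ⁴ δ ∼ (M/2r)⁴ δ` is a second asymptotically flat end (the
inversion through the throat is an isometry). Brill–Lindquist, Phys. Rev. 131 (1963);
MTW 1973, §31.7; Bartnik 1986, §1. (False for `M = 0`: punctured flat `ℝ³` is incomplete.)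
Named fact (D-0014; `0 < M` and the standing hypothesis `[(timeSymmetricData …).metric.HasLeviCivita]`
of `InitialDataSet.IsComplete` are leading binders). [cite: MTW1973, §31.7] -/
def isComplete_timeSymmetricData (M : ℝ) : Prop :=
  ∀ (hM : 0 < M) [(timeSymmetricData M hM.le).metric.HasLeviCivita],
    (timeSymmetricData M hM.le).IsComplete

/-! #### The minimal throat `‖y‖ = M/2` as a MOTS -/

/-- The **throat embedding** of the unit `2`-sphere onto the coordinate sphere `‖y‖ = M/2` of
the punctured slice, `ω ↦ (M/2) ω` (`M > 0`). Mathlib's `Metric.sphere (0 : E3) 1` with its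
analytic manifold structure (`EuclideanSpace.instIsManifoldSphere`) is the surface manifold.
MTW 1973, §31.7; Bray 2001, §1. [cite: MTW1973, §31.7] -/
def throatEmbed (M : ℝ) (hM : 0 < M) : Metric.sphere (0 : E3) 1 → puncturedSlice :=
  fun p ↦ ⟨(M / 2) • (p : E3), by
    rw [mem_puncturedSlice, norm_smul, norm_eq_of_mem_sphere p, mul_one, Real.norm_eq_abs,
      abs_of_pos (by positivity)]
    positivity⟩

/-- Unfolding lemma: `throatEmbed M hM p = (M/2) p` in `E3` (MTW 1973, §31.7). [cite: MTW1973, §31.7] -/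
@[simp]
theorem coe_throatEmbed (M : ℝ) (hM : 0 < M) (p : Metric.sphere (0 : E3) 1) :
    (throatEmbed M hM p : E3) = (M / 2) • (p : E3) := rfl

/-- The throat lies on the coordinate sphere `‖y‖ = M/2` (MTW 1973, §31.7). [cite: MTW1973, §31.7] -/
theorem norm_coe_throatEmbed (M : ℝ) (hM : 0 < M) (p : Metric.sphere (0 : E3) 1) :
    ‖(throatEmbed M hM p : E3)‖ = M / 2 := by
  rw [coe_throatEmbed, norm_smul, norm_eq_of_mem_sphere p, mul_one, Real.norm_eq_abs,
    abs_of_pos (by positivity)]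

/-- The **outward `h`-unit normal** of the throat: `ν(ω) = ψ⁻² ω = ω/4` (`ψ = 2` on
`‖y‖ = M/2`, `h(ν, ν) = ψ⁴ ‖ν‖² = 1`). MTW 1973, §31.7; Bray 2001, §1. [cite: MTW1973, §31.7] -/
def throatNormal (M : ℝ) (hM : 0 < M) : NormalField 𝓘(ℝ, E3) (throatEmbed M hM) :=
  fun p ↦ (4 : ℝ)⁻¹ • (p : E3)

/-- Unfolding lemma: `throatNormal M hM p = p/4` (MTW 1973, §31.7). [cite: MTW1973, §31.7] -/
@[simp]
theorem throatNormal_apply (M : ℝ) (hM : 0 < M) (p : Metric.sphere (0 : E3) 1) :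
    throatNormal M hM p = (4 : ℝ)⁻¹ • (p : E3) := rfl

/-- The throat embedding is a spacelike (i.e. Riemannian) immersion of `S²` into
`(E3 ∖ {0}, ψ⁴ δ)`: it is smooth (a dilation of Mathlib's analytic inclusion
`contMDiff_coe_sphere`) with injective differential. MTW 1973, §31.7; O'Neill 1983, Ch. 4.
Named fact (D-0014; `0 < M` is the leading binder); it is the hypothesis `hf` of the MOTS
statement `isMOTSInData_throat`. [cite: MTW1973, §31.7] -/
def isSpacelikeImmersion_throatEmbed (M : ℝ) : Prop :=
  ∀ hM : 0 < M,
    (PseudoRiemannianMetric.ofRiemannian (timeSymmetricData M hM.le).h).IsSpacelikeImmersion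
      (𝓡 2) (throatEmbed M hM)

/-- **The throat is a MOTS of the time-symmetric Schwarzschild data**: the coordinate sphere
`‖y‖ = M/2` is a minimal surface of `ψ⁴ δ` (`H = ψ⁻²(H_δ + 4 ∂_r log ψ) = ψ⁻²(2/r − 2M/(r²ψ))`
vanishes at `r = M/2`, `ψ = 2`), hence `θ⁺ = tr_S k + H = 0` with `k = 0`
(`isMOTSInData_zero_iff`). It is the outermost minimal surface, of area `16π M²`, realising
equality in the Riemannian Penrose inequality. MTW 1973, §31.7; Bray, J. Diff. Geom. 59
(2001), §1; Huisken–Ilmanen, J. Diff. Geom. 59 (2001), §1. Named fact (D-0014). Following the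
drifted signature of `IsMOTSInData` (`TrappedSurface`), the leading binders are `0 < M`, the
pullback-smoothness fact `hpb : contMDiff_pullbackBilin …` for maps `S² → E3 ∖ {0}`
(`Isometry.lean`), the spacelike-immersion fact `hf` (named fact
`isSpacelikeImmersion_throatEmbed`) and the standing Levi-Civita hypothesis of the data metric. [cite: MTW1973, §31.7] -/
def isMOTSInData_throat (M : ℝ) : Prop :=
  ∀ (hM : 0 < M)
    (hpb : PseudoRiemannianMetric.contMDiff_pullbackBilin 𝓘(ℝ, E3) puncturedSlice (𝓡 2)
      (Metric.sphere (0 : E3) 1) ∞)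
    (hf : (PseudoRiemannianMetric.ofRiemannian
      (timeSymmetricData M hM.le).h).IsSpacelikeImmersion (𝓡 2) (throatEmbed M hM))
    [(PseudoRiemannianMetric.ofRiemannian (timeSymmetricData M hM.le).h).HasLeviCivita],
    IsMOTSInData (timeSymmetricData M hM.le).h (timeSymmetricData M hM.le).k (throatEmbed M hM)
      hpb hf (throatNormal M hM)

end Schwarzschild

/-! ### Discharge of `Minkowski.isSmoothEmbedding_sliceEmbed` (Hawking–Ellis 1973, §2.3, §2.7, §5.1)

Hawking–Ellis 1973, §2.3, p. 23: a `C^r` map `φ : 𝓜 → 𝓜'` is an *immersion* if locally it has a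
`C^r` inverse on its image (equivalently, for `r ≥ 1`, `φ_*` is injective; in adapted charts
`φ` reads `u ↦ (u, 0)` — Mathlib's `Manifold.IsImmersion`), and an *imbedding* if moreover it
is a homeomorphism onto its image (`Topology.IsEmbedding`); §2.7, p. 44: a hypersurface is the
image of an imbedding of an `(n-1)`-manifold; §5.1, pp. 118–119: Minkowski space-time is `R⁴`
with `η` in the natural coordinates `(x¹, x², x³, x⁴)` and the surfaces `{x⁴ = constant}` are
(Cauchy) three-surfaces. For the slice `{t = 0}` both halves are elementary and proved here at
Mathlib level: the immersion charts are the identity charts of the open submanifold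
`slice ⊆ E3` and of `E4` with the linear isomorphism `E3 × ℝ ≅ E4`, `(y, t) ↦ (t, y)`
(complement `F = ℝ`), and the embedding half follows from the continuous left inverse
`E4.spatial` of `y ↦ (0, y)`. -/

namespace E4

/-- `E4.ofTimeSpace` is jointly additive: `(t + t', y + y') = (t, y) + (t', y')`
(coordinatewise). Dafermos–Rodnianski, arXiv:0811.0354, §5.1 (Cartesian coordinates
`(t*, x, y, z)`). [cite: arXiv08110354] -/
theorem ofTimeSpace_add (t t' : ℝ) (y y' : E3) :
    ofTimeSpace (t + t') (y + y') = ofTimeSpace t y + ofTimeSpace t' y' := by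
  ext i
  refine Fin.cases ?_ (fun j ↦ ?_) i
  · simp
  · simp

/-- `E4.ofTimeSpace` is jointly homogeneous: `(c t, c y) = c (t, y)` (coordinatewise).
Dafermos–Rodnianski, arXiv:0811.0354, §5.1. [cite: arXiv08110354] -/
theorem ofTimeSpace_smul (c t : ℝ) (y : E3) :
    ofTimeSpace (c * t) (c • y) = c • ofTimeSpace t y := by
  ext i
  refine Fin.cases ?_ (fun j ↦ ?_) i
  · simp
  · simp

end E4

namespace Minkowski

/-- The slice embedding `y ↦ (0, y)` is continuous (Hawking–Ellis 1973, §5.1: `{x⁴ = 0}` is a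
three-surface of Minkowski space-time `R⁴`). [cite: HawkingEllis1973, §5.1 pp. 118-119] -/
theorem continuous_sliceEmbed : Continuous sliceEmbed :=
  (E4.continuous_ofTimeSpace 0).comp continuous_subtype_val

/-- The slice embedding `y ↦ (0, y)` is a topological embedding — a homeomorphism onto its
image, the second half of Hawking–Ellis's definition of an imbedding (§2.3, p. 23): `y ↦ (0, y)`
has the continuous left inverse `E4.spatial` (`Topology.IsEmbedding.of_leftInverse`), and the
inclusion of the open set `slice ⊆ E3` is an embedding. [cite: HawkingEllis1973, §2.3 p. 23 and §5.1 pp. 118-119] -/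
theorem isEmbedding_sliceEmbed : Topology.IsEmbedding sliceEmbed := by
  have h0 : Topology.IsEmbedding (E4.ofTimeSpace 0) :=
    Topology.IsEmbedding.of_leftInverse (f := E4.spatial) (fun y ↦ E4.spatial_ofTimeSpace 0 y)
      E4.spatial.continuous (E4.continuous_ofTimeSpace 0)
  exact h0.comp Topology.IsEmbedding.subtypeVal

/-- The slice embedding `y ↦ (0, y)` is a `C^∞` immersion in the chart sense of Hawking–Ellis
1973, §2.3, p. 23 (Mathlib's `Manifold.IsImmersion`): with respect to the complement `F = ℝ`
and the linear isomorphism `E3 × ℝ ≅ E4`, `(y, t) ↦ (t, y)`, it reads `u ↦ (u, 0)` in the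
preferred charts of the open submanifold `slice ⊆ E3` (restrictions of the identity,
`OpenPartialHomeomorph.subtypeRestr_symm_apply`) and the identity chart of `E4`
(`Manifold.IsImmersionAtOfComplement.mk_of_continuousAt`). Hawking–Ellis 1973, §2.3 and §5.1
(natural coordinates `(x¹, x², x³, x⁴)` on `R⁴`, the surfaces `{x⁴ = constant}`). [cite: HawkingEllis1973, §2.3 p. 23 and §5.1 pp. 118-119] -/
theorem isImmersion_sliceEmbed : Manifold.IsImmersion 𝓘(ℝ, E3) 𝓘(ℝ, E4) ∞ sliceEmbed := by
  -- the linear isomorphism `(y, t) ↦ (t, y) : E3 × ℝ ≅ E4` (continuous: finite dimension)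
  let eₗ : (E3 × ℝ) ≃ₗ[ℝ] E4 :=
    { toFun := fun p ↦ E4.ofTimeSpace p.2 p.1
      map_add' := fun p q ↦ E4.ofTimeSpace_add p.2 q.2 p.1 q.1
      map_smul' := fun c p ↦ E4.ofTimeSpace_smul c p.2 p.1
      invFun := fun v ↦ (E4.spatial v, E4.time v)
      left_inv := fun p ↦ by simp
      right_inv := fun v ↦ E4.ofTimeSpace_time_spatial v }
  let e : (E3 × ℝ) ≃L[ℝ] E4 := eₗ.toContinuousLinearEquiv
  have he : ∀ p : E3 × ℝ, e p = E4.ofTimeSpace p.2 p.1 := fun _ ↦ rfl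
  refine ⟨ℝ, inferInstance, inferInstance, fun x ↦ ?_⟩
  refine Manifold.IsImmersionAtOfComplement.mk_of_continuousAt
    continuous_sliceEmbed.continuousAt e (chartAt E3 x) (chartAt E4 (sliceEmbed x))
    (mem_chart_source E3 x) (mem_chart_source E4 (sliceEmbed x))
    (IsManifold.chart_mem_maximalAtlas x) (IsManifold.chart_mem_maximalAtlas (sliceEmbed x)) ?_
  intro z hz
  -- `z` lies in the target of the preferred chart of `slice` at `x`
  have hz' : z ∈ (chartAt E3 x).target := by
    rw [OpenPartialHomeomorph.extend_target] at hz
    exact hz.1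
  -- the inverse chart of the open submanifold `slice` is the identity on coordinates
  have key : (((chartAt E3 x).symm z : slice) : E3) = z := by
    have h := (chartAt E3 (x : E3)).subtypeRestr_symm_apply ⟨x⟩ hz'
    rw [chartAt_self_eq, OpenPartialHomeomorph.refl_symm] at h
    exact h
  calc ((chartAt E4 (sliceEmbed x)).extend 𝓘(ℝ, E4))
        (sliceEmbed (((chartAt E3 x).extend 𝓘(ℝ, E3)).symm z))
      = sliceEmbed ((chartAt E3 x).symm z) := rfl
    _ = E4.ofTimeSpace 0 z := by rw [sliceEmbed_apply, key]
    _ = e (z, 0) := (he (z, 0)).symm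

/-- **Discharge of the named fact `isSmoothEmbedding_sliceEmbed`.** The slice embedding
`y ↦ (0, y)` of `{x⁴ = 0} ≅ R³` into Minkowski space-time `R⁴` is a smooth embedding — an
imbedding in the sense of Hawking–Ellis 1973, §2.3, p. 23 (an immersion which is a
homeomorphism onto its image), so that `{x⁴ = 0}` is a hypersurface (§2.7, p. 44), the `t = 0`
member of the family `{x⁴ = constant}` of §5.1, pp. 118–119. Assembled from
`isImmersion_sliceEmbed` and `isEmbedding_sliceEmbed`. [cite: HawkingEllis1973, §2.3 p. 23 and §5.1 pp. 118-119] -/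
theorem isSmoothEmbedding_sliceEmbed_holds : isSmoothEmbedding_sliceEmbed :=
  ⟨isImmersion_sliceEmbed, isEmbedding_sliceEmbed⟩

end Minkowski

end Literature.Geometry.Lorentzian

end
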